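import Literature.MathematicalPhysics.QuantumFieldTheory.Balaban1983to89.B8Thm2SetupTorus
import HarnessLib

/-!
# Route `UnitScaleTilt`, crux K1 child «MinimiserStabilityRegPr» (stmt-QuantumFields-19200), registered stub `stub_prop7From14` (skeleton birth_v7
# cc37a178…; leaf V3) — DICTIONARY: PRINT'S BASED LETTERS ARE THE B8 LANE'S ORIGIN-BASED LETTERS OF THE TRANSLATED CONFIGURATION (torus homogeneity):
# `InAx … (V₀♯_{x₀}) (V♯_{x₀}) = InAxT P k (τ_{x₀}V₀) (τ_{x₀}V)`, `Restr129 … (V₀♯_{x₀}) (v♯_{x₀}) = Restr129T P k (τ_{x₀}V₀) (τ_{x₀}v)`, and the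
# classes (1.33)/(1.34)₁ `InSpace` (all-torus) and (1.35) `Hyp135T` transported likewise — so [Balaban1985RegularSpaces] Thm 2 for the based letters
# of `Prop7AxialReprPrint` ∕ `Prop7ChartPrint` IS `B8Thm2SetupTorus.Thm2SetupAt` ∕ `Thm2SetupSUAt` at the translated data

Cell `ym3-torus` ∕ fleet seat `ym-ust-19200-p1` (gen 8; HUMAN RULING D-0037, YM ladder rung R3).  WHY.  Gen 8's files prove the Sect. A laws of the V3 knit
for the letters (1.19)/(1.29) read on pullbacks BASED AT THE `k`-CENTRE `x₀ = embIter k 0` (CARD-19200-V3-g8 §1(c): the T³ group (4) pins the centres,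
the `ℤᵈ` lanes pin the corners).  The B8 lane's interface for [Balaban1985RegularSpaces] Thm 2 (`B8Thm2SetupTorus.Thm2SetupAt`/`Thm2SetupSUAt`) is
written with ORIGIN-based pullbacks (`cfgPull P U = U♯_0`, `gaugePull P u = u♯_0`).  This file records the one-line dictionary a pen of P-V3-A needs:
the based pullback of `V` is the origin-based pullback of the TRANSLATE `τ_{x₀}V : b ↦ V(b + (x₀ − 0))`, so every origin-based letter of the B8 lane
evaluated at translated data is the corresponding based letter — hypotheses (1.33)₁/(1.34) (`InSpace` on the whole torus is translation invariant,
`InAxT`), (1.35) (`Hyp135T`), and the restriction (1.29) (`Restr129T`) alike; the conclusion `Concl2Setup` transports the same way (its letters are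
origin-based pullbacks too).

WHAT IS PROVED (sorry-free, no definition; the translate is written inline as `fun b => V ⟨transl b.src (rel 0 x₀), b.dir⟩`).
§1 `pull_translate` (`(τ_{x₀}V)♯_0 = V♯_{x₀}`), `pullGauge_translate`, `holT_translate` (transports of the translate are translated transports).
§2 `cfgPull_translate`, `gaugePull_translate`, **`inAxT_translate_iff`**, **`restr129T_translate_iff`**, **`hyp135T_translate_iff`** (`U(N)` letters).
§3 **`inSpace_univ_translate_iff`** — [Balaban1985Variational] (2) ∕ [Balaban1985RegularSpaces] (1.7)–(1.9) on the whole torus is invariant under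
   translations (via `B8Thm2SetupTorus.inSpace_univ_iff_inAk_pull` and the `ℤᵈ` class at the two base points: `pull V x₀ = shiftCfg (rel 0 x₀) (pull V 0)`,
   `B8Ineq132.InAk` on `univ` is `shiftCfg`-invariant).

HONEST SCOPE.  Definitional bookkeeping (torus homogeneity); nothing of Thm 2 is proved; count-neutral helper toward stmt-QuantumFields-19200
(`--supports`), not a proof of the stub.

References: T. Bałaban, CMP 99 (1985) 75–102 [Balaban1985RegularSpaces] ((1.3) p.77, (1.7)–(1.9) p.77, (1.19) p.79, (1.29) p.81, (1.33)–(1.35) p.82,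
Thm 2 p.83); CMP 98 (1985) 17–51 [Balaban1985Averaging] (p.19 «Ω^{(j)} may be replaced by any other lattice»).
-/

noncomputable section

namespace Summit.QuantumFields.YangMills.Theorems.Prop7BasedTranslate

open Literature.MathematicalPhysics.QuantumFieldTheory.Balaban1983to89
open B7Prop1Explicit renaming Site → LSite
open B7Prop1Explicit (e)
open B12Ineq417Flat (shiftCfg shiftCfg_apply)
open B8Ineq132 (InAk)
open B8Eq119TwistedAxial (InAx Restr129)
open B8Eq133Hypotheses (Hyp135)
open B8Thm4TorusAt (torusLam)
open B10Eq27TorusAxialLog (transl transl_apply transl_zero transl_add transl_add_e transl_sub_e transl_rel rel pull pull_apply holT holT_nil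
  holT_cons_true holT_cons_false unitsField)
open B10Eq68TorusRegularity (InSpace)
open B8Thm2SetupTorus (pullGauge pullGauge_apply cfgPull gaugePull InAxT Restr129T Hyp135T inSpace_univ_iff_inAk_pull)

variable {P : Params} {j : ℕ}

/-! ## §1 The translate and its pullbacks -/

section Translate

variable {G : Type*}

/-- `x₀ + z = 0 + ((x₀ − 0) + z)`. [cite: Balaban1987RG1, (0.1) p.251] -/
theorem transl_eq_transl_zero (x₀ : Site P j) (z : LSite P.d) : transl x₀ z = transl 0 (rel 0 x₀ + z) := by
  rw [transl_add, transl_rel]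

/-- **THE ORIGIN-BASED PULLBACK OF THE TRANSLATE IS THE BASED PULLBACK**: `(τ_{x₀}V)♯_0 = V♯_{x₀}`. [cite: Balaban1985RegularSpaces, (1.3) p.77] -/
theorem pull_translate (V : GaugeField P j G) (x₀ : Site P j) :
    pull (fun b : PBond P j => V ⟨transl b.src (rel 0 x₀), b.dir⟩) 0 = pull V x₀ := by
  funext z μ
  rw [pull_apply, pull_apply, ← transl_add, add_comm, ← transl_eq_transl_zero]

/-- The same for gauge transformations: `(τ_{x₀}v)♯_0 = v♯_{x₀}`. [cite: Balaban1985Averaging, (8) p.19] -/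
theorem pullGauge_translate (v : GaugeTransf P j G) (x₀ : Site P j) :
    pullGauge (fun x => v (transl x (rel 0 x₀))) 0 = pullGauge v x₀ := by
  funext z
  rw [pullGauge_apply, pullGauge_apply, ← transl_add, add_comm, ← transl_eq_transl_zero]

/-- The based pullback is a translate of the origin-based one: `V♯_{x₀} = t_{x₀ − 0}(V♯_0)`. [cite: Balaban1985RegularSpaces, (1.3) p.77] -/
theorem pull_eq_shiftCfg (V : GaugeField P j G) (x₀ : Site P j) : pull V x₀ = shiftCfg (rel 0 x₀) (pull V 0) := by
  funext z μ
  rw [shiftCfg_apply, pull_apply, pull_apply, transl_eq_transl_zero, add_comm]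

end Translate

/-! ## §2 The `U(N)` letters of `B8Thm2SetupTorus` at translated data are the based letters -/

section Letters

open scoped Matrix.Norms.L2Operator

variable {N : ℕ}

/-- `cfgPull P (τ_{x₀}U) = (unitsField U)♯_{x₀}`. [cite: Balaban1985RegularSpaces, (1.3) p.77] -/
theorem cfgPull_translate (U : GaugeField P 0 (Matrix.unitaryGroup (Fin N) ℂ)) (x₀ : Site P 0) :
    cfgPull P (fun b : PBond P 0 => U ⟨transl b.src (rel 0 x₀), b.dir⟩) = pull (unitsField U) x₀ := by
  unfold cfgPull
  rw [← pull_translate (unitsField U) x₀]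
  rfl

/-- `gaugePull P (τ_{x₀}u) = (toUnits ∘ u)♯_{x₀}`. [cite: Balaban1985Averaging, (8) p.19] -/
theorem gaugePull_translate (u : GaugeTransf P 0 (Matrix.unitaryGroup (Fin N) ℂ)) (x₀ : Site P 0) :
    gaugePull P (fun x => u (transl x (rel 0 x₀))) = pullGauge (fun x => Unitary.toUnits (u x)) x₀ := by
  unfold gaugePull
  rw [← pullGauge_translate _ x₀]

/-- **(1.34)₂ ∕ (1.19)**: `InAxT P k (τU₀) (τU)` IS the based reading `InAx L k (torusLam k) (U₀♯_{x₀}) (U♯_{x₀})`.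
[cite: Balaban1985RegularSpaces, (1.19) p.79, (1.34) p.82] -/
theorem inAxT_translate_iff (k : ℕ) (U₀ U : GaugeField P 0 (Matrix.unitaryGroup (Fin N) ℂ)) (x₀ : Site P 0) :
    InAxT P k (fun b : PBond P 0 => U₀ ⟨transl b.src (rel 0 x₀), b.dir⟩) (fun b : PBond P 0 => U ⟨transl b.src (rel 0 x₀), b.dir⟩) ↔
      InAx P.L k (torusLam k) (pull (unitsField U₀) x₀) (pull (unitsField U) x₀) := by
  unfold InAxT
  rw [cfgPull_translate, cfgPull_translate]

/-- **(1.29)**: `Restr129T P k (τU₀) (τu)` IS the based reading `Restr129 L k (torusLam k) (U₀♯_{x₀}) (u♯_{x₀})`.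
[cite: Balaban1985RegularSpaces, (1.29) p.81] -/
theorem restr129T_translate_iff (k : ℕ) (U₀ : GaugeField P 0 (Matrix.unitaryGroup (Fin N) ℂ)) (u : GaugeTransf P 0 (Matrix.unitaryGroup (Fin N) ℂ))
    (x₀ : Site P 0) :
    Restr129T P k (fun b : PBond P 0 => U₀ ⟨transl b.src (rel 0 x₀), b.dir⟩) (fun x => u (transl x (rel 0 x₀))) ↔
      Restr129 P.L k (torusLam k) (pull (unitsField U₀) x₀) (pullGauge (fun x => Unitary.toUnits (u x)) x₀) := by
  unfold Restr129T
  rw [cfgPull_translate, gaugePull_translate]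

/-- **(1.35)**: `Hyp135T P k α₁ (τU₀) (τU′)` IS the based reading `Hyp135 L k (torusLam k) α₁ (U₀♯_{x₀}) (U′♯_{x₀})`.
[cite: Balaban1985RegularSpaces, (1.35) p.82] -/
theorem hyp135T_translate_iff (k : ℕ) (α₁ : ℝ) (U₀ U' : GaugeField P 0 (Matrix.unitaryGroup (Fin N) ℂ)) (x₀ : Site P 0) :
    Hyp135T P k α₁ (fun b : PBond P 0 => U₀ ⟨transl b.src (rel 0 x₀), b.dir⟩) (fun b : PBond P 0 => U' ⟨transl b.src (rel 0 x₀), b.dir⟩) ↔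
      Hyp135 P.L k (torusLam k) α₁ (pull (unitsField U₀) x₀) (pull (unitsField U') x₀) := by
  unfold Hyp135T
  rw [cfgPull_translate, cfgPull_translate]

end Letters

/-! ## §3 (1.33)₁ ∕ (1.34)₁ on the whole torus is translation invariant -/

section Space

open scoped Matrix.Norms.L2Operator

variable {N : ℕ}

/-- The plaquette field of a translated configuration is the translated plaquette field. [cite: Balaban1985RegularSpaces, (1.2) p.76] -/
theorem plaqF_shiftCfg {𝔸 : Type*} [NormedRing 𝔸] (a : LSite P.d) (V : LSite P.d → Fin P.d → 𝔸ˣ) (μ ν : Fin P.d) (x : LSite P.d) :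
    B8Ineq132.plaqF (shiftCfg a V) μ ν x = B8Ineq132.plaqF V μ ν (x + a) := by
  unfold B8Ineq132.plaqF
  rw [B12Ineq417Flat.hol_shiftCfg]

/-- The covariant divergence (1.2) of a translated configuration is the translated divergence. [cite: Balaban1985RegularSpaces, (1.2) p.76] -/
theorem covDiv_shiftCfg {𝔸 : Type*} [NormedRing 𝔸] [NormedAlgebra ℂ 𝔸] (η : ℝ) (a : LSite P.d) (V : LSite P.d → Fin P.d → 𝔸ˣ) (μ : Fin P.d)
    (x : LSite P.d) : B8Ineq132.covDiv η (shiftCfg a V) μ x = B8Ineq132.covDiv η V μ (x + a) := by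
  have hp : ∀ κ ν : Fin P.d, B8Ineq132.plaqF (shiftCfg a V) κ ν = fun y => B8Ineq132.plaqF V κ ν (y + a) :=
    fun κ ν => funext (plaqF_shiftCfg a V κ ν)
  unfold B8Ineq132.covDiv B8Ineq132.covDeriv
  simp only [hp, shiftCfg_apply, add_sub_right_comm]

/-- The `ℤᵈ` class `𝔄_k` on `Ω_j = ℤᵈ` is invariant under translations of the configuration. [cite: Balaban1985RegularSpaces, (1.7)-(1.9) p.77] -/
theorem inAk_univ_shiftCfg_iff {𝔸 : Type*} [NormedRing 𝔸] [NormedAlgebra ℂ 𝔸] [CompleteSpace 𝔸] (L k : ℕ) (η α : ℝ) (a : LSite P.d)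
    (V : LSite P.d → Fin P.d → 𝔸ˣ) :
    InAk L k η α (fun _ => (Set.univ : Set (LSite P.d))) (shiftCfg a V) ↔ InAk L k η α (fun _ => (Set.univ : Set (LSite P.d))) V := by
  constructor
  · intro h jl hjl
    obtain ⟨h1, h2⟩ := h jl hjl
    refine ⟨fun z μ ν hne _ => ?_, fun z μ _ => ?_⟩
    · have := h1 (z - a) μ ν hne (Or.inl (Set.mem_univ _))
      rwa [plaqF_shiftCfg, sub_add_cancel] at this
    · have := h2 (z - a) μ (Or.inl (Set.mem_univ _))
      rwa [covDiv_shiftCfg, sub_add_cancel] at this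
  · intro h jl hjl
    obtain ⟨h1, h2⟩ := h jl hjl
    refine ⟨fun z μ ν hne _ => ?_, fun z μ _ => ?_⟩
    · rw [plaqF_shiftCfg]; exact h1 (z + a) μ ν hne (Or.inl (Set.mem_univ _))
    · rw [covDiv_shiftCfg]; exact h2 (z + a) μ (Or.inl (Set.mem_univ _))

/-- **[Balaban1985Variational] (2) ∕ [Balaban1985RegularSpaces] (1.7)–(1.9) ON THE WHOLE TORUS IS TRANSLATION INVARIANT**: the class `InSpace` (both
clauses, all scales, `Ω_j = T_η`) of the translate `τ_{x₀}U` is that of `U` (the `ℤᵈ` classes of the two pullbacks differ by a translation).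
[cite: Balaban1985RegularSpaces, (1.7)-(1.9) p.77, p.77 («Ω_j = T_η»); Balaban1985Variational, (2) p.278] -/
theorem inSpace_univ_translate_iff [NeZero N] (k : ℕ) (ε₀ η : ℝ) (U : GaugeField P 0 (Matrix.unitaryGroup (Fin N) ℂ)) (x₀ : Site P 0) :
    InSpace k (fun _ => (Set.univ : Set (Site P 0))) ε₀ η (fun b : PBond P 0 => U ⟨transl b.src (rel 0 x₀), b.dir⟩) ↔
      InSpace k (fun _ => (Set.univ : Set (Site P 0))) ε₀ η U := by
  rw [inSpace_univ_iff_inAk_pull, inSpace_univ_iff_inAk_pull]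
  have h1 : unitsField (fun b : PBond P 0 => U ⟨transl b.src (rel 0 x₀), b.dir⟩) =
      fun b : PBond P 0 => unitsField U ⟨transl b.src (rel 0 x₀), b.dir⟩ := rfl
  rw [h1, pull_translate, pull_eq_shiftCfg]
  exact inAk_univ_shiftCfg_iff _ _ _ _ _ _

end Space

end Summit.QuantumFields.YangMills.Theorems.Prop7BasedTranslate

end
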